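import Literature.NumberTheory.ComplexMultiplication.FaltingsTateOfPrimitiveCMProducts
import HarnessLib

/-!
# [Faltings 1983, §5 Kor. 1] for products of CM structures of pairwise INEQUIVALENT primitive types

Theorems only (topic `NumberTheory/ComplexMultiplication`; no definition, no named fact, no instance).
Sequel of `FaltingsTateOfPrimitiveCMProducts`, whose off-diagonal hypothesis «the CM fields `K_i` are pairwise
non-isomorphic» is replaced here by the optimal geometric one: «no field isomorphism `θ : K_i ≃ K_{i'}`
carries the type `Φ_i` to `Φ_{i'}`» (`inducedCMType θ Φ_i ≠ Φ_{i'}`) — i.e. the structures may have the SAME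
CM field as long as their primitive types are `Aut`-inequivalent, which is exactly the condition for the
abelian varieties not to be isogenous even geometrically.

§1 (type recovery, [Shimura1998, §13.1 (7)] read both ways).  At a rational prime `p` completely split in a
normal `L` receiving `k` (`σL`, `k ⊇ K*`) and `K₁, K₂` (`j₁, j₂`), let `(π_i) = N_{Ψ_i}(v)` be the reflex type
norms of a place `v ∣ p` for two types `Φ₁ ⊆ Hom(K₁, L)`, `Φ₂ ⊆ Hom(K₂, L)`.  The set of primes of `L`
dividing `j_i(π_i)` is `S*_{Φ_i, j_i} · 𝔓` (★ `map_span_le_smul_iff_mem_reflexLift`), so a relation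
`j₂(π₂)𝔬_L = u(j₁(π₁)𝔬_L)`, `u ∈ Gal(L/ℚ)`, forces `S*_{Φ₂,j₂} = u S*_{Φ₁,j₁}`, i.e.
`g ∘ j₂ ∈ Φ₂ ⟺ g ∘ u ∘ j₁ ∈ Φ₁` for all `g ∈ Aut(L)`
(`smul_mem_iff_smul_smul_mem_of_isReflexTypeNorm_of_map_eq_smul`).
§2.  If moreover `ℚ(π₁) = K₁`, `ℚ(π₂) = K₂` and `π₂` is a root of the minimal polynomial of `π₁`, there is a
field isomorphism `θ : K₁ ≃ K₂` with `θ π₁ = π₂` (`exists_ringEquiv_apply_eq_of_aeval_minpoly_eq_zero`), and then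
`j₂ ∘ θ = u ∘ j₁` for some `u`, whence **`Φ₂ = inducedCMType θ Φ₁`** at the level of complex CM types
(`inducedCMType_eq_of_isReflexTypeNorm_of_apply_eq`).
§3.  A normal hull of `k` and finitely many `K_i` inside `ℂ`.
§4 (head).  For finitely many structures `(A_i, ι_i)` of PRIMITIVE types `(K_i, Φ_i)` over one `k` with pairwise
inequivalent types, `faltings_tate_bijective (A_i) (A_{i'}) ℓ` for all `i, i'` (off the diagonal both Tate sides
vanish: the common scalar Frobenius of ★ `exists_splitsCompletely_frobenius_isReflexTypeNorm_family` has
`minpoly(π_i)(π_{i'}) ≠ 0` by §2), hence **`faltings_tate_bijective A B ℓ` for every `A ~ ⨁_s A_{c s}`,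
`B ~ ⨁_t A_{d t}`** (★ `faltings_tate_bijective_of_isIsogenous_biproduct_biproduct`).  Granted
[Shimura1998, Thm. 18.6] (`h186`; ★ `shimura1998_thm18_6_holds` Summits-side).  The remaining pairs — equivalent
types, i.e. geometrically isogenous structures that need not be `k`-isogenous (twists) — are not treated here.

## References

* [Faltings1983Endlichkeit] G. Faltings, Invent. Math. 73 (1983), §5 Korollar 1 (the statement decided).
* [Shimura1998] G. Shimura, *Abelian Varieties with Complex Multiplication and Modular Functions*
  (1998), §8.2 Prop. 26; §8.3 Prop. 28; §13.1 (7) and Thm. 1; §13.2 Thm. 2 (proof); §18.5 (18.5a); §18.6 Thm. 18.6.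
* [SerreTate1968] J.-P. Serre, J. Tate, Ann. of Math. 88 (1968), §4 Theorem 5 and Corollary 1.
-/

noncomputable section

open scoped NumberField
open NumberField IsDedekindDomain CategoryTheory CategoryTheory.Limits Polynomial
open Literature.AlgebraicGeometry.Motives Literature.AlgebraicGeometry.Motives.AbelianVariety
open Literature.NumberTheory.GaloisRepresentations
open scoped Pointwise IntermediateField

namespace Literature.NumberTheory.ComplexMultiplication

/-! ## §0 Plumbing -/

/-- Every ring automorphism of a characteristic-zero field `L` is a `ℚ`-algebra automorphism. [folklore] -/
private theorem exists_algEquiv_coe_eq_ringEquiv {L : Type*} [Field L] [CharZero L] (g : L ≃+* L) :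
    ∃ g' : L ≃ₐ[ℚ] L, (g' : L ≃+* L) = g :=
  ⟨AlgEquiv.ofRingEquiv (f := g) (fun x => (g : L →+* L).map_rat_algebraMap x), by ext x; rfl⟩

/-- Every complex embedding of `K` factors through a normal number field `L ⊆ ℂ` receiving `K`. [folklore] -/
private theorem exists_comp_eq_of_normal {K L : Type} [Field K] [NumberField K] [Field L] [NumberField L]
    [Normal ℚ L] (ιL : L →+* ℂ) (j : K →+* L) (τ : K →+* ℂ) : ∃ ψ : K →+* L, ιL.comp ψ = τ := by
  haveI := Literature.AlgebraicGeometry.Pohlmann1968.isPretransitive_ringEquiv_complex (K := K)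
  obtain ⟨c, hc⟩ := MulAction.exists_smul_eq (ℂ ≃+* ℂ) (ιL.comp j) τ
  obtain ⟨ψL, hψL⟩ := exists_algHom_comp_eq_of_normal (AlgHom.id ℚ L) ιL ((c : ℂ →+* ℂ).comp ιL)
  refine ⟨(ψL : L →+* L).comp j, ?_⟩
  rw [← RingHom.comp_assoc, hψL, RingHom.comp_assoc, ← hc, ringEquiv_smul_def, RingEquiv.toRingHom_eq_coe]

/-! ## §1 Type recovery from the ideal factorisation at a completely split place -/

/-- **[Shi98] §13.1 (7), read both ways, compares two types through ONE place**: for types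
`Φ₁ ⊆ Hom(K₁, L)`, `Φ₂ ⊆ Hom(K₂, L)` (`L/ℚ` Galois, `k ⊇ K*` for both in the form `Stab(σL) ≤ Stab(Φ_i)`), a
completely split `p`, `v ∋ p`, reflex type norms `(π_i) = N_{Ψ_i}(v)` and `u ∈ Gal(L/ℚ)` with
`j₂(π₂)𝔬_L = u (j₁(π₁)𝔬_L)`: `S*_{Φ₂, j₂} = u S*_{Φ₁, j₁}` (the primes dividing `j_i(π_i)` are `S*_{Φ_i,j_i} 𝔓`,
★ `map_span_le_smul_iff_mem_reflexLift`), stated on types as `g ∘ j₂ ∈ Φ₂ ⟺ g ∘ (u ∘ j₁) ∈ Φ₁` for every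
`g ∈ Aut(L)`. [cite: Shimura1998, §13.1 (7), p. 97; §8.3 Prop. 28] -/
theorem smul_mem_iff_smul_smul_mem_of_isReflexTypeNorm_of_map_eq_smul
    {k K₁ K₂ L : Type*} [Field k] [NumberField k] [Field K₁] [NumberField K₁] [Field K₂] [NumberField K₂]
    [Field L] [NumberField L] [IsGalois ℚ L]
    (Φ₁ : Set (K₁ →+* L)) (Φ₂ : Set (K₂ →+* L)) (j₁ : K₁ →+* L) (j₂ : K₂ →+* L) (σL : k →+* L)
    (hk₁ : MulAction.stabilizer (L ≃+* L) σL ≤ MulAction.stabilizer (L ≃+* L) Φ₁)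
    (hk₂ : MulAction.stabilizer (L ≃+* L) σL ≤ MulAction.stabilizer (L ≃+* L) Φ₂)
    {p : ℕ} (hp : p.Prime) (hsplit : SplitsCompletely L p)
    (v : HeightOneSpectrum (𝓞 k)) (hv : ((p : ℕ) : 𝓞 k) ∈ v.asIdeal) {π₁ : 𝓞 K₁} {π₂ : 𝓞 K₂}
    (hπ₁ : IsReflexTypeNorm Φ₁ j₁ σL v.asIdeal (Ideal.span {π₁}))
    (hπ₂ : IsReflexTypeNorm Φ₂ j₂ σL v.asIdeal (Ideal.span {π₂})) (u : L ≃ₐ[ℚ] L)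
    (hu : (Ideal.span {π₂} : Ideal (𝓞 K₂)).map (RingOfIntegers.mapRingHom j₂) =
      u • (Ideal.span {π₁} : Ideal (𝓞 K₁)).map (RingOfIntegers.mapRingHom j₁))
    (g : L ≃+* L) : g • j₂ ∈ Φ₂ ↔ g • ((u : L ≃+* L) • j₁) ∈ Φ₁ := by
  classical
  -- a prime `𝔓` of `L` above `v` (going up along `σL`)
  obtain ⟨𝔓, h𝔓prime, h𝔓⟩ : ∃ 𝔓 : Ideal (𝓞 L), 𝔓.IsPrime ∧
      v.asIdeal.map (RingOfIntegers.mapRingHom σL) ≤ 𝔓 := by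
    letI : Algebra k L := σL.toAlgebra
    have hσL : RingOfIntegers.mapRingHom σL = algebraMap (𝓞 k) (𝓞 L) := rfl
    haveI := v.isPrime
    obtain ⟨⟨𝔓, h𝔓prime, h𝔓over⟩⟩ := (inferInstance : Nonempty (Ideal.primesOver v.asIdeal (𝓞 L)))
    refine ⟨𝔓, h𝔓prime, ?_⟩
    rw [hσL, Ideal.map_le_iff_le_comap]
    exact h𝔓over.over.le
  haveI := h𝔓prime
  -- `S*₂ = u S*₁` through the primes dividing `j_i(π_i)`
  have key : ∀ h : L ≃ₐ[ℚ] L, ((h : L ≃ₐ[ℚ] L) : L ≃+* L) ∈ (reflexLift Φ₂ j₂ : Set (L ≃+* L)) ↔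
      ((u⁻¹ * h : L ≃ₐ[ℚ] L) : L ≃+* L) ∈ (reflexLift Φ₁ j₁ : Set (L ≃+* L)) := fun h => by
    rw [← map_span_le_smul_iff_mem_reflexLift Φ₂ j₂ σL hk₂ hp hsplit v hv h𝔓 hπ₂ h,
      ← map_span_le_smul_iff_mem_reflexLift Φ₁ j₁ σL hk₁ hp hsplit v hv h𝔓 hπ₁ (u⁻¹ * h), hu, mul_smul]
    constructor
    · intro hle
      have h2 : u⁻¹ • u • (Ideal.span {π₁} : Ideal (𝓞 K₁)).map (RingOfIntegers.mapRingHom j₁) ≤ u⁻¹ • h • 𝔓 :=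
        Ideal.pointwise_smul_le_pointwise_smul_iff.mpr hle
      rwa [inv_smul_smul] at h2
    · intro hle
      have h2 : u • (Ideal.span {π₁} : Ideal (𝓞 K₁)).map (RingOfIntegers.mapRingHom j₁) ≤ u • u⁻¹ • h • 𝔓 :=
        Ideal.pointwise_smul_le_pointwise_smul_iff.mpr hle
      rwa [smul_inv_smul] at h2
  -- read on `g = h⁻¹`
  obtain ⟨g', rfl⟩ := exists_algEquiv_coe_eq_ringEquiv g
  have h1 := key g'⁻¹
  rw [mem_reflexLift, mem_reflexLift] at h1
  have e1 : ((g'⁻¹ : L ≃ₐ[ℚ] L) : L ≃+* L)⁻¹ = ((g' : L ≃ₐ[ℚ] L) : L ≃+* L) := by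
    ext x; simp [AlgEquiv.aut_inv]
  have e2 : ((u⁻¹ * g'⁻¹ : L ≃ₐ[ℚ] L) : L ≃+* L)⁻¹ = ((g' : L ≃ₐ[ℚ] L) : L ≃+* L) * ((u : L ≃ₐ[ℚ] L) : L ≃+* L) := by
    ext x; simp [AlgEquiv.aut_inv, AlgEquiv.aut_mul]
  rw [e1, e2, mul_smul] at h1
  exact h1

/-! ## §2 A common root gives a type-preserving field isomorphism -/

/-- **A common minimal polynomial gives a field isomorphism matching the generators**: if `ℚ(π₁) = K₁`,
`ℚ(π₂) = K₂` and `π₂` is a root of `minpoly_ℤ(π₁)`, then `θ π₁ = π₂` for some `θ : K₁ ≃+* K₂`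
(`K₁ ≅ ℚ[X]/(m) → K₂`, onto because `π₂` generates). [folklore] -/
private theorem exists_ringEquiv_apply_eq_of_aeval_minpoly_eq_zero
    {K₁ K₂ : Type} [Field K₁] [NumberField K₁] [Field K₂] [NumberField K₂]
    (π₁ : 𝓞 K₁) (π₂ : 𝓞 K₂) (hπ₁ : ℚ⟮(π₁ : K₁)⟯ = ⊤) (hπ₂ : ℚ⟮(π₂ : K₂)⟯ = ⊤)
    (h : aeval π₂ (minpoly ℤ π₁) = 0) : ∃ θ : K₁ ≃+* K₂, θ (π₁ : K₁) = (π₂ : K₂) := by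
  have hπ₁Q : IsIntegral ℚ (π₁ : K₁) := (NumberField.RingOfIntegers.isIntegral_coe π₁).tower_top
  set m : ℚ[X] := minpoly ℚ (π₁ : K₁) with hm
  have hmZ : m = (minpoly ℤ π₁).map (algebraMap ℤ ℚ) := by
    rw [hm, ← NumberField.RingOfIntegers.minpoly_coe π₁]
    exact minpoly.isIntegrallyClosed_eq_field_fractions' ℚ (NumberField.RingOfIntegers.isIntegral_coe π₁)
  have hroot : aeval (π₂ : K₂) m = 0 := by
    rw [hmZ, aeval_map_algebraMap, NumberField.RingOfIntegers.coe_eq_algebraMap, aeval_algebraMap_apply,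
      h, map_zero]
  -- `θ₀ : K₁ = ℚ⟮π₁⟯ ≅ AdjoinRoot m → K₂`, root ↦ `π₂`
  let e₁ : K₁ ≃ₐ[ℚ] AdjoinRoot m :=
    (((IntermediateField.equivOfEq hπ₁).trans IntermediateField.topEquiv).symm.trans
      (IntermediateField.adjoinRootEquivAdjoin ℚ hπ₁Q).symm)
  have hroot' : m.eval₂ (Algebra.ofId ℚ K₂) (π₂ : K₂) = 0 := hroot
  let θ₀ : K₁ →ₐ[ℚ] K₂ :=
    (AdjoinRoot.liftAlgHom m (Algebra.ofId ℚ K₂) (π₂ : K₂) hroot').comp (e₁ : K₁ →ₐ[ℚ] AdjoinRoot m)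
  have hθ₀ : θ₀ (π₁ : K₁) = (π₂ : K₂) := by
    have he₁ : e₁ (π₁ : K₁) = AdjoinRoot.root m := by
      change (IntermediateField.adjoinRootEquivAdjoin ℚ hπ₁Q).symm
        (((IntermediateField.equivOfEq hπ₁).trans IntermediateField.topEquiv).symm (π₁ : K₁)) = _
      rw [AlgEquiv.symm_apply_eq, IntermediateField.adjoinRootEquivAdjoin_apply_root]
      apply ((IntermediateField.equivOfEq hπ₁).trans IntermediateField.topEquiv).injective
      rw [AlgEquiv.apply_symm_apply]
      rfl
    change AdjoinRoot.liftAlgHom m (Algebra.ofId ℚ K₂) (π₂ : K₂) hroot' (e₁ (π₁ : K₁)) = _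
    rw [he₁, AdjoinRoot.liftAlgHom_root]
  -- onto: `π₂` generates `K₂`
  have hsurj : Function.Surjective θ₀ := by
    have hrange : θ₀.fieldRange = ⊤ := by
      rw [eq_top_iff, ← hπ₂, IntermediateField.adjoin_simple_le_iff]
      exact ⟨(π₁ : K₁), hθ₀⟩
    intro y
    have hy : y ∈ θ₀.fieldRange := by rw [hrange]; exact IntermediateField.mem_top
    obtain ⟨x, hx⟩ := AlgHom.mem_fieldRange.1 hy
    exact ⟨x, hx⟩
  exact ⟨(AlgEquiv.ofBijective θ₀ ⟨θ₀.toRingHom.injective, hsurj⟩).toRingEquiv, hθ₀⟩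

/-- **Two structures read through one completely split place have `θ`-related types when their Frobenius
generators are `θ`-related** ([Shi98] §13.1 (7) + §8.3 Prop. 28): in the situation of
`smul_mem_iff_smul_smul_mem_of_isReflexTypeNorm_of_map_eq_smul`, if `θ : K₁ ≃ K₂` has `θ π₁ = π₂`, then the
complex CM types satisfy `Φ₂ = inducedCMType θ Φ₁` (`τ ∈ Φ₂ ⟺ τ ∘ θ ∈ Φ₁`): `j₂ ∘ θ = u ∘ j₁` for some
`u ∈ Gal(L/ℚ)` (`L` normal), `j₂(π₂)𝔬_L = u(j₁(π₁)𝔬_L)`, §1, and every embedding of `K₂` into `ℂ` or `L` is a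
translate of `j₂`. [cite: Shimura1998, §13.1 (7) and Thm. 1 (ii), pp. 97–98; §8.3 Prop. 28] -/
theorem inducedCMType_eq_of_isReflexTypeNorm_of_apply_eq
    {k K₁ K₂ L : Type} [Field k] [NumberField k] [Field K₁] [NumberField K₁] [IsCMField K₁]
    [Field K₂] [NumberField K₂] [IsCMField K₂] [Field L] [NumberField L] [IsGalois ℚ L] (ιL : L →+* ℂ)
    (Φ₁ : CMType K₁) (Φ₂ : CMType K₂) (j₁ : K₁ →+* L) (j₂ : K₂ →+* L) (σL : k →+* L)
    (hk₁ : MulAction.stabilizer (L ≃+* L) σL ≤ MulAction.stabilizer (L ≃+* L) (valuedIn ιL Φ₁.1))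
    (hk₂ : MulAction.stabilizer (L ≃+* L) σL ≤ MulAction.stabilizer (L ≃+* L) (valuedIn ιL Φ₂.1))
    {p : ℕ} (hp : p.Prime) (hsplit : SplitsCompletely L p)
    (v : HeightOneSpectrum (𝓞 k)) (hv : ((p : ℕ) : 𝓞 k) ∈ v.asIdeal) {π₁ : 𝓞 K₁} {π₂ : 𝓞 K₂}
    (hπ₁ : IsReflexTypeNorm (valuedIn ιL Φ₁.1) j₁ σL v.asIdeal (Ideal.span {π₁}))
    (hπ₂ : IsReflexTypeNorm (valuedIn ιL Φ₂.1) j₂ σL v.asIdeal (Ideal.span {π₂}))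
    (θ : K₁ ≃+* K₂) (hθ : θ (π₁ : K₁) = (π₂ : K₂)) :
    inducedCMType (θ : K₁ →+* K₂) Φ₁ = Φ₂ := by
  classical
  -- `j₂ ∘ θ = u ∘ j₁`
  obtain ⟨u', hu'⟩ := exists_ringEquiv_smul_eq j₁ (j₂.comp (θ : K₁ →+* K₂))
  obtain ⟨u, rfl⟩ := exists_algEquiv_coe_eq_ringEquiv u'
  -- `j₂(π₂)𝔬_L = u (j₁(π₁)𝔬_L)`
  have hθint : RingOfIntegers.mapRingHom (θ : K₁ →+* K₂) π₁ = π₂ := RingOfIntegers.ext (by simpa using hθ)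
  have hu : (Ideal.span {π₂} : Ideal (𝓞 K₂)).map (RingOfIntegers.mapRingHom j₂) =
      u • (Ideal.span {π₁} : Ideal (𝓞 K₁)).map (RingOfIntegers.mapRingHom j₁) := by
    have hcomp : RingOfIntegers.mapRingHom (j₂.comp (θ : K₁ →+* K₂)) =
        (RingOfIntegers.mapRingHom j₂).comp (RingOfIntegers.mapRingHom (θ : K₁ →+* K₂)) :=
      RingHom.ext fun _ => RingOfIntegers.ext rfl
    rw [← map_mapRingHom_algEquiv_smul u j₁, hu', hcomp, ← Ideal.map_map,
      Ideal.map_span (RingOfIntegers.mapRingHom (θ : K₁ →+* K₂)), Set.image_singleton, hθint]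
  -- §1: `g ∘ j₂ ∈ Φ₂ ⟺ (g ∘ j₂) ∘ θ ∈ Φ₁` for all `g`
  have hL : ∀ ψ : K₂ →+* L, ψ ∈ valuedIn ιL Φ₂.1 ↔ ψ.comp (θ : K₁ →+* K₂) ∈ valuedIn ιL Φ₁.1 := by
    intro ψ
    obtain ⟨g, rfl⟩ := exists_ringEquiv_smul_eq j₂ ψ
    rw [smul_mem_iff_smul_smul_mem_of_isReflexTypeNorm_of_map_eq_smul (valuedIn ιL Φ₁.1) (valuedIn ιL Φ₂.1)
      j₁ j₂ σL hk₁ hk₂ hp hsplit v hv hπ₁ hπ₂ u hu g, hu']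
    simp only [ringEquiv_smul_def, RingEquiv.toRingHom_eq_coe, RingHom.comp_assoc]
  -- every complex embedding of `K₂` factors through `ιL`
  refine Subtype.ext (Set.ext fun τ => ?_)
  obtain ⟨ψ, rfl⟩ := exists_comp_eq_of_normal ιL j₂ τ
  rw [mem_inducedCMType_iff, RingHom.comp_assoc, ← mem_valuedIn_iff, ← mem_valuedIn_iff]
  exact (hL ψ).symm

/-! ## §3 A normal hull of `k` and finitely many `K_i` inside `ℂ` -/

/-- **A finite normal subextension `L ⊆ ℂ` of `ℚ` containing `k` (along its structure map) and a copy of every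
`K_i`** (`i` in a finite index type): `L := normalClosure ℚ k ℂ ⊔ ⨆_i normalClosure ℚ (K_i) ℂ` — Shimura's
«Taking a Galois extension `L` of **Q** containing `K`» ((18.5a)) for several `K` at once; Milne's «choose a
subfield `L` of `ℚ̄` containing `E` and Galois over `ℚ`». [cite: Shimura1998, §18.5 (18.5a), p. 123]
[cite: MilneCM2006, Ch. I §1 Ex. 1.28] -/
theorem exists_normal_intermediateField_complex_forall (k : Type) [Field k] [NumberField k]
    [Algebra k ℂ] {ι : Type} [Finite ι] (K : ι → Type) [∀ i, Field (K i)] [∀ i, NumberField (K i)] :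
    ∃ L : IntermediateField ℚ ℂ, FiniteDimensional ℚ L ∧ Normal ℚ L ∧
      (∀ x : k, algebraMap k ℂ x ∈ L) ∧ ∀ i, ∃ τ : K i →+* ℂ, ∀ y : K i, τ y ∈ L := by
  have τ : ∀ i, K i →+* ℂ := fun i => Classical.choice (NumberField.Embeddings.instNonemptyRingHom (K i) ℂ)
  haveI h1 : IsNormalClosure ℚ k (IntermediateField.normalClosure ℚ k ℂ) :=
    Algebra.IsAlgebraic.isNormalClosure_normalClosure fun x => IsAlgClosed.splits _
  haveI h2 : ∀ i, IsNormalClosure ℚ (K i) (IntermediateField.normalClosure ℚ (K i) ℂ) := fun i =>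
    Algebra.IsAlgebraic.isNormalClosure_normalClosure fun x => IsAlgClosed.splits _
  have hN1 : Normal ℚ (IntermediateField.normalClosure ℚ k ℂ) := IsNormalClosure.normal (K := k)
  have hN2 : ∀ i, Normal ℚ (IntermediateField.normalClosure ℚ (K i) ℂ) := fun i =>
    IsNormalClosure.normal (K := K i)
  have hN3 : Normal ℚ (⨆ i, IntermediateField.normalClosure ℚ (K i) ℂ : IntermediateField ℚ ℂ) :=
    IntermediateField.normal_iSup (h := hN2) _
  refine ⟨IntermediateField.normalClosure ℚ k ℂ ⊔ ⨆ i, IntermediateField.normalClosure ℚ (K i) ℂ,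
    IntermediateField.finiteDimensional_sup _ _,
    @IntermediateField.normal_sup ℚ ℂ _ _ _ _ _ hN1 hN3, fun x => ?_, fun i => ⟨τ i, fun y => ?_⟩⟩
  · exact SetLike.le_def.1 (le_sup_left : IntermediateField.normalClosure ℚ k ℂ ≤ _)
      (AlgHom.fieldRange_le_normalClosure (IsScalarTower.toAlgHom ℚ k ℂ) ⟨x, rfl⟩)
  · refine SetLike.le_def.1 (le_sup_right : (⨆ i, IntermediateField.normalClosure ℚ (K i) ℂ) ≤ _) ?_
    exact SetLike.le_def.1 (le_iSup (fun i => IntermediateField.normalClosure ℚ (K i) ℂ) i)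
      (AlgHom.fieldRange_le_normalClosure (τ i).toRatAlgHom ⟨y, rfl⟩)

/-! ## §4 [Fal83 §5 Kor. 1] for pairwise inequivalent primitive types -/

/-- **ONE place decides all pairs**: for finitely many structures `(A_i, ι_i)` of PRIMITIVE types `(K_i, Φ_i)` over
one `k` and a prime `ℓ`, some `σ₀ ∈ Γ_k` acts on every `T_ℓ A_i` as `T_ℓ(ι_i π_i)` with `ℚ(π_i) = K_i`, and for
all `i ≠ i'` either `minpoly(π_i)(π_{i'}) ≠ 0` or the types are equivalent through some `θ : K_i ≃ K_{i'}`
(`inducedCMType θ Φ_i = Φ_{i'}`) — §2 at the common place of ★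
`exists_splitsCompletely_frobenius_isReflexTypeNorm_family`.  Granted [Shimura1998, Thm. 18.6] (`h186`).
[cite: Shimura1998, §13.1 (7) and Thm. 1 (ii); §13.2 Thm. 2 (proof); §18.6 Thm. 18.6] -/
theorem exists_common_tateRep_eq_and_aeval_ne_zero_or_inducedCMType_eq (h186 : shimura1998_thm18_6)
    {k : Type} [Field k] [NumberField k] [Algebra k ℂ] {ι : Type} [Finite ι]
    {K : ι → Type} [∀ i, Field (K i)] [∀ i, NumberField (K i)] [∀ i, IsCMField (K i)]
    (Φ : ∀ i, CMType (K i)) (A : ι → AbelianVariety k) (ιA : ∀ i, 𝓞 (K i) →+* CategoryTheory.End (A i))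
    (hA : ∀ i, IsCMTypeRealisationOver (Φ i) (A i) (ιA i)) {φ₀ : ∀ i, K i →+* ℂ}
    (hprim : ∀ i, IsPrimitive (ℂ ≃+* ℂ) (Φ i).1 (φ₀ i)) (ℓ : ℕ) [Fact ℓ.Prime] :
    ∃ (σ₀ : Field.absoluteGaloisGroup k) (π : ∀ i, 𝓞 (K i)),
      (∀ i, (A i).tateRep ℓ σ₀ = tateModuleMap ℓ (ιA i (π i) : A i ⟶ A i) ∧ ℚ⟮(π i : K i)⟯ = ⊤) ∧
      ∀ i i', aeval (π i') (minpoly ℤ (π i)) ≠ 0 ∨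
        ∃ θ : K i ≃+* K i', inducedCMType (θ : K i →+* K i') (Φ i) = Φ i' := by
  obtain ⟨L, hfd, hnorm, hk, hK⟩ := exists_normal_intermediateField_complex_forall k K
  choose τ hτ using hK
  haveI : FiniteDimensional ℚ L := hfd
  haveI : Normal ℚ L := hnorm
  haveI : NumberField L := NumberField.of_module_finite ℚ L
  haveI : IsGalois ℚ L := ⟨⟩
  let ιL : L →+* ℂ := algebraMap L ℂ
  let σL : k →+* L := (algebraMap k ℂ).codRestrict L hk
  let j : ∀ i, K i →+* L := fun i => (τ i).codRestrict L (hτ i)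
  have hcomp : ιL.comp σL = algebraMap k ℂ := RingHom.ext fun _ => rfl
  obtain ⟨p, v, σ₀, hp, hsplit, hpv, -, hall⟩ :=
    exists_splitsCompletely_frobenius_isReflexTypeNorm_family h186 Φ A ιA hA ℓ L ιL j σL hcomp
  choose π hπσ hrefl using hall
  have hkΦ : ∀ i, MulAction.stabilizer (L ≃+* L) σL ≤ MulAction.stabilizer (L ≃+* L) (valuedIn ιL (Φ i).1) :=
    fun i => stabilizer_le_stabilizer_valuedIn ιL (Φ i) (hA i) σL hcomp
  have hgen : ∀ i, ℚ⟮(π i : K i)⟯ = ⊤ := fun i =>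
    adjoin_eq_top_of_isReflexTypeNorm_of_isPrimitive_of_splitsCompletely (valuedIn ιL (Φ i).1) (j i) σL
      (isPrimitive_valuedIn_of_isPrimitive_complex ιL (Φ i) (hprim i) (j i)) (hkΦ i) hp hsplit v hpv (hrefl i)
  refine ⟨σ₀, π, fun i => ⟨hπσ i, hgen i⟩, fun i i' => ?_⟩
  by_cases h : aeval (π i') (minpoly ℤ (π i)) = 0
  · right
    obtain ⟨θ, hθ⟩ := exists_ringEquiv_apply_eq_of_aeval_minpoly_eq_zero (π i) (π i') (hgen i) (hgen i') h
    exact ⟨θ, inducedCMType_eq_of_isReflexTypeNorm_of_apply_eq ιL (Φ i) (Φ i') (j i) (j i') σL (hkΦ i) (hkΦ i')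
      hp hsplit v hpv (hrefl i) (hrefl i') θ hθ⟩
  · exact Or.inl h

/-- **[Fal83 §5 Kor. 1] for every PAIR of factors of a finite family of primitive CM structures with pairwise
INEQUIVALENT types** over the same `k` (`k ⊆ ℂ`; the predicate quantifies over `[NumberField k]`), granted
[Shimura1998, Thm. 18.6]: if no field isomorphism `θ : K_i ≃ K_{i'}` (`i ≠ i'`) has `inducedCMType θ Φ_i = Φ_{i'}`,
then `faltings_tate_bijective (A i) (A i') ℓ` for all `i, i'` — diagonal ★
`bijective_faltingsTateMap_of_isCMTypeRealisationOver_of_tateRep_eq`, off-diagonal both sides vanish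
(★ `bijective_faltingsTateMap_of_tateRep_eq_of_aeval_ne_zero`). [cite: Faltings1983Endlichkeit, §5 Korollar 1]
[cite: SerreTate1968, §4 Theorem 5 and Corollary 1] [cite: Shimura1998, §13.1 Thm. 1, §13.2 Thm. 2 (proof), §18.6 Thm. 18.6] -/
theorem faltings_tate_bijective_of_isPrimitive_of_inducedCMType_ne (h186 : shimura1998_thm18_6)
    {k : Type} [Field k] [Algebra k ℂ] {ι : Type} [Finite ι]
    {K : ι → Type} [∀ i, Field (K i)] [∀ i, NumberField (K i)] [∀ i, IsCMField (K i)]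
    (Φ : ∀ i, CMType (K i)) (A : ι → AbelianVariety k) (ιA : ∀ i, 𝓞 (K i) →+* CategoryTheory.End (A i))
    (hA : ∀ i, IsCMTypeRealisationOver (Φ i) (A i) (ιA i)) {φ₀ : ∀ i, K i →+* ℂ}
    (hprim : ∀ i, IsPrimitive (ℂ ≃+* ℂ) (Φ i).1 (φ₀ i))
    (hK : ∀ i i', i ≠ i' → ∀ θ : K i ≃+* K i', inducedCMType (θ : K i →+* K i') (Φ i) ≠ Φ i')
    (ℓ : ℕ) [Fact ℓ.Prime] (i i' : ι) : faltings_tate_bijective (A i) (A i') ℓ := by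
  intro _
  obtain ⟨σ₀, π, hπ, hoff⟩ :=
    exists_common_tateRep_eq_and_aeval_ne_zero_or_inducedCMType_eq h186 Φ A ιA hA hprim ℓ
  by_cases hii' : i = i'
  · subst hii'
    exact bijective_faltingsTateMap_of_isCMTypeRealisationOver_of_tateRep_eq (Φ i) (A i) (ιA i) (hA i) ℓ
      σ₀ (π i) (hπ i).1 (hπ i).2
  · have hu : aeval (π i') (minpoly ℤ (π i)) ≠ 0 := by
      rcases hoff i i' with h | ⟨θ, hθ⟩
      · exact h
      · exact absurd hθ (hK i i' hii' θ)
    exact bijective_faltingsTateMap_of_tateRep_eq_of_aeval_ne_zero (A i) (A i') (ιA i) (ιA i') ℓ σ₀ (π i) (π i')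
      (hπ i).1 (hπ i').1 hu

/-- **[Fal83 §5 Kor. 1] for arbitrary finite products, with multiplicities, of primitive CM structures with
pairwise INEQUIVALENT types, and their isogeny classes** — granted [Shimura1998, Thm. 18.6]: for index maps
`c : S → ι`, `d : T → ι`, every `A` isogenous to `⨁_s A_{c s}` and every `B` isogenous to `⨁_t A_{d t}` satisfy
`faltings_tate_bijective A B ℓ` (★ `faltings_tate_bijective_of_isIsogenous_biproduct_biproduct` over the pairs).
Generalises ★ `faltings_tate_bijective_of_isIsogenous_biproduct_of_isPrimitive_family` (pairwise non-isomorphic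
fields: then there is no `θ` at all, `AlgEquiv.ofRingEquiv`). [cite: Faltings1983Endlichkeit, §5 Korollar 1 and §5 ¶1] [cite: Shimura1998, §13.2 Thm. 2 (proof) and §18.6 Thm. 18.6] -/
theorem faltings_tate_bijective_of_isIsogenous_biproduct_of_inducedCMType_ne (h186 : shimura1998_thm18_6)
    {k : Type} [Field k] [Algebra k ℂ] {ι : Type} [Finite ι]
    {K : ι → Type} [∀ i, Field (K i)] [∀ i, NumberField (K i)] [∀ i, IsCMField (K i)]
    (Φ : ∀ i, CMType (K i)) (A : ι → AbelianVariety k) (ιA : ∀ i, 𝓞 (K i) →+* CategoryTheory.End (A i))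
    (hA : ∀ i, IsCMTypeRealisationOver (Φ i) (A i) (ιA i)) {φ₀ : ∀ i, K i →+* ℂ}
    (hprim : ∀ i, IsPrimitive (ℂ ≃+* ℂ) (Φ i).1 (φ₀ i))
    (hK : ∀ i i', i ≠ i' → ∀ θ : K i ≃+* K i', inducedCMType (θ : K i →+* K i') (Φ i) ≠ Φ i')
    (ℓ : ℕ) [Fact ℓ.Prime] {S T : Type} [Fintype S] [Fintype T] (c : S → ι) (d : T → ι)
    {A' B' : AbelianVariety k} (hA' : IsIsogenous (⨁ fun s => A (c s)) A')
    (hB' : IsIsogenous (⨁ fun t => A (d t)) B') : faltings_tate_bijective A' B' ℓ :=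
  faltings_tate_bijective_of_isIsogenous_biproduct_biproduct ℓ _ _ hA' hB' fun s t =>
    faltings_tate_bijective_of_isPrimitive_of_inducedCMType_ne h186 Φ A ιA hA hprim hK ℓ (c s) (d t)

end Literature.NumberTheory.ComplexMultiplication

end
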